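import Summits.CriticalPhenomena.CardyFormulaZ2.Theorems.CardyComplexConeEdgePrecompactUFRSAnnulusCrossings
import Summits.CriticalPhenomena.CardyFormulaZ2.Theorems.CardyComplexConeEdgePrecompactUFRSEvents
import Literature.Probability.Percolation.AnnulusCrossingBoundProofs
import Literature.Probability.Percolation.FiniteEnergy

/-!
# UFRS, decay at the marked points (rectangles), part 2: locality of the strand-crossing events
(line `qkz-strip-boundary-arm` of crux `CardyComplexCone.EdgePrecompact`, stmt-CriticalPhenomena-11387;
support for the registered sub-goal `ufrs_markedPointDecay_rect`, wave 3 of lead c4)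

The event `ufrsStrands E w z k r R` ("`k` pairwise corner-disjoint simple orbit stretches of the two
dynamics crossing the annulus `A(z; r, R)`", `…EdgePrecompactUFRSEvents.lean`) is **determined by the
edges of the closed annulus `r - 2δ ≤ |·-z| ≤ R + 2δ`** (`determinedBy_ufrsStrands_W3M`), hence
measurable (`measurableSet_ufrsStrands_W3M`), and strand events in disjoint annuli are independent
under `P_{1/2}` (`bondPercolation_real_inter_of_disjoint` with `disjoint_edgeBands_W3M`).

Proof ("stop at the first exit, start at the last entrance", orbit locality): a witnessing stretch
`O c [i, j]` from the `r`-ball to distance `≥ R` contains a TIGHT sub-stretch `O c [i', j']` — `j'`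
the first exit beyond `R`, `i'` the last visit of the `r`-ball before it (`exists_tightStretch_W3M`) —
all of whose corners before the last have their vertex in the open annulus `r - δ < |·-z| < R + δ`,
so that the target edges read by the successor map (`cornerOrbit_congr`, Duminil-Copin–Smirnov 2012,
§6.2) lie in the closed annulus; re-rooting the stretch at `O c i'` (`cornerOrbit_add_eq`) makes it a
witness for every configuration with the same edges there, the completed configurations
`E.bcBondConfig`, `(shiftData E w).bcBondConfig` reading `ω` edge by edge (`mem_bcBondConfig_iff`).
The combinatorial core is `strands_transfer_W3M`, stated for an arbitrary family of configurations.

References: H. Duminil-Copin, S. Smirnov, Conformal invariance of lattice models, Clay Math. Proc. 15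
(2012), §6.2 (measurability of exploration prefixes); G. Grimmett, Percolation (1999), §2.2.
-/

namespace Summit.CriticalPhenomena.CardyFormulaZ2.Cruxes.EdgePrecompact.QkzStripBoundaryArm

open MeasureTheory Filter Set Metric
open scoped Topology BigOperators Pointwise
open Literature.Probability.LatticeModels Literature.Probability.Percolation
open Literature.Probability.RandomPlanarGeometry (DobrushinDomain)
open Summit.CriticalPhenomena.CardyFormulaZ2.Theses.CardyComplexCone

noncomputable section

/-! ## Edge-by-edge locality of the boundary conditions -/

/-- The completed configuration reads `ω` edge by edge: configurations with the same status at `e`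
complete to configurations with the same status at `e`. -/
theorem bcBondConfig_congr_W3M (D : DiscreteDobrushin) {ω ω' : BondConfig (Site 2)} {e : Sym2 (Site 2)}
    (h : e ∈ ω ↔ e ∈ ω') : (e ∈ D.bcBondConfig ω ↔ e ∈ D.bcBondConfig ω') := by
  rw [DiscreteDobrushin.mem_bcBondConfig_iff, DiscreteDobrushin.mem_bcBondConfig_iff, h]

/-! ## Tight sub-stretches -/

/-- **Last index.** If `P i` holds and `i ≤ n`, there is a LAST index `s ∈ [i, n]` with `P s`. -/
theorem exists_lastIndex_W3M (P : ℕ → Prop) {i n : ℕ} (hin : i ≤ n) (hi : P i) :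
    ∃ s, i ≤ s ∧ s ≤ n ∧ P s ∧ ∀ u, s < u → u ≤ n → ¬ P u := by
  classical
  refine ⟨Nat.findGreatest P n, Nat.le_findGreatest hin hi, Nat.findGreatest_le n,
    Nat.findGreatest_spec hin hi, fun u hsu hun => Nat.findGreatest_is_greatest hsu hun⟩

/-- **Tight sub-stretch of a crossing.** A real sequence moving by at most `δ > 0` per step which
joins `(-∞, r]` to `[R, ∞)` (in either order) on `[i, j]` does so on a sub-interval
`[i', j'] ⊆ [i, j]` all of whose values before the last lie in the open interval `(r - δ, R + δ)`
(first reach of the far side, last visit of the near side before it). -/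
theorem exists_tightStretch_W3M (g : ℕ → ℝ) {δ r R : ℝ} (hδ : 0 < δ)
    (hstep : ∀ t, |g (t + 1) - g t| ≤ δ) {i j : ℕ} (hij : i ≤ j)
    (hcross : (g i ≤ r ∧ R ≤ g j) ∨ (R ≤ g i ∧ g j ≤ r)) :
    ∃ i' j', i ≤ i' ∧ i' ≤ j' ∧ j' ≤ j ∧ ((g i' ≤ r ∧ R ≤ g j') ∨ (R ≤ g i' ∧ g j' ≤ r)) ∧
      ∀ t, i' ≤ t → t < j' → r - δ < g t ∧ g t < R + δ := by
  rcases hcross with ⟨hi, hj⟩ | ⟨hi, hj⟩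
  · -- outward: first exit beyond `R`, last visit of the `r`-ball before it
    obtain ⟨j', hij', hj'j, hRj', hbefore⟩ := exists_firstFarIndex g R hij hj
    obtain ⟨i', hii', hi'j', hri', hafter⟩ := exists_lastIndex_W3M (fun s => g s ≤ r) hij' hi
    refine ⟨i', j', hii', hi'j', hj'j, Or.inl ⟨hri', hRj'⟩, fun t hit htj => ?_⟩
    constructor
    · rcases Nat.lt_or_ge i' t with hlt | hge
      · have := not_le.1 (hafter t hlt htj.le)
        linarith
      · have ht : t = i' := le_antisymm hge hit
        subst ht
        rcases Nat.lt_or_ge t j' with hlt' | hge'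
        · have h1 := not_le.1 (hafter (t + 1) (Nat.lt_succ_self t) hlt')
          have h2 := hstep t
          rw [abs_le] at h2
          linarith [h2.2]
        · omega
    · linarith [hbefore t (le_trans hii' hit) htj]
  · -- inward: first visit of the `r`-ball, last far index before it
    obtain ⟨j', hij', hj'j, hrj', hbefore⟩ :=
      exists_firstFarIndex (fun t => - g t) (-r) hij (by simpa using hj)
    obtain ⟨i', hii', hi'j', hRi', hafter⟩ := exists_lastIndex_W3M (fun s => R ≤ g s) hij' hi
    have hrj'' : g j' ≤ r := by simpa using hrj'
    refine ⟨i', j', hii', hi'j', hj'j, Or.inr ⟨hRi', hrj''⟩, fun t hit htj => ?_⟩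
    constructor
    · have := hbefore t (le_trans hii' hit) htj
      simp only [neg_lt_neg_iff] at this
      linarith
    · rcases Nat.lt_or_ge i' t with hlt | hge
      · have := not_le.1 (hafter t hlt htj.le)
        linarith
      · have ht : t = i' := le_antisymm hge hit
        subst ht
        rcases Nat.lt_or_ge t j' with hlt' | hge'
        · have h1 := not_le.1 (hafter (t + 1) (Nat.lt_succ_self t) hlt')
          have h2 := hstep t
          rw [abs_le] at h2
          linarith [h2.1]
        · omega

/-! ## Transfer of strand witnesses between configurations agreeing on the annulus -/

/-- **Transfer of a strand-crossing family** (combinatorial core of the locality). Let `β`, `β'` be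
two families of configurations such that, for every `a`, `β' a` and `β a` have the same status at the
target edge of every corner whose vertex lies in the open annulus `r - δ < |· - z| < R + δ`
(`0 < δ`). Then every family of `k` pairwise corner-disjoint simple stretches of `β`-orbits
crossing `A(z; r, R)`, through faces satisfying `In a`, yields such a family for `β'`: tighten each
stretch (`exists_tightStretch_W3M`), re-root it at its first corner (`cornerOrbit_add_eq`), and
compare the orbits (`cornerOrbit_congr`). -/
theorem strands_transfer_W3M {k : ℕ} (β β' : Fin k → BondConfig (Site 2)) (In : Fin k → Site 2 → Prop)
    {δ r R : ℝ} (hδ : 0 < δ) (z : ℂ)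
    (hagree : ∀ a (p : Site 2 × Fin 4), r - δ < dist (meshPoint δ p.1) z → dist (meshPoint δ p.1) z < R + δ →
      (cTgt p ∈ β' a ↔ cTgt p ∈ β a))
    (h : ∃ (c : Fin k → Site 2 × Fin 4) (i j : Fin k → ℕ), (∀ a, i a ≤ j a ∧
      ((dist (meshPoint δ (cornerOrbit (β a) (c a) (i a)).1) z ≤ r ∧ R ≤ dist (meshPoint δ (cornerOrbit (β a) (c a) (j a)).1) z) ∨
        (R ≤ dist (meshPoint δ (cornerOrbit (β a) (c a) (i a)).1) z ∧ dist (meshPoint δ (cornerOrbit (β a) (c a) (j a)).1) z ≤ r)) ∧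
      (∀ t, i a ≤ t → t ≤ j a → In a (cFace (cornerOrbit (β a) (c a) t))) ∧
      (∀ s t, i a ≤ s → s < t → t ≤ j a → cornerOrbit (β a) (c a) s ≠ cornerOrbit (β a) (c a) t)) ∧
      (∀ a b, a ≠ b → ∀ s t, i a ≤ s → s ≤ j a → i b ≤ t → t ≤ j b → cornerOrbit (β a) (c a) s ≠ cornerOrbit (β b) (c b) t)) :
    ∃ (c : Fin k → Site 2 × Fin 4) (i j : Fin k → ℕ), (∀ a, i a ≤ j a ∧
      ((dist (meshPoint δ (cornerOrbit (β' a) (c a) (i a)).1) z ≤ r ∧ R ≤ dist (meshPoint δ (cornerOrbit (β' a) (c a) (j a)).1) z) ∨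
        (R ≤ dist (meshPoint δ (cornerOrbit (β' a) (c a) (i a)).1) z ∧ dist (meshPoint δ (cornerOrbit (β' a) (c a) (j a)).1) z ≤ r)) ∧
      (∀ t, i a ≤ t → t ≤ j a → In a (cFace (cornerOrbit (β' a) (c a) t))) ∧
      (∀ s t, i a ≤ s → s < t → t ≤ j a → cornerOrbit (β' a) (c a) s ≠ cornerOrbit (β' a) (c a) t)) ∧
      (∀ a b, a ≠ b → ∀ s t, i a ≤ s → s ≤ j a → i b ≤ t → t ≤ j b → cornerOrbit (β' a) (c a) s ≠ cornerOrbit (β' b) (c b) t) := by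
  obtain ⟨c, i, j, h, hdis⟩ := h
  -- tighten every stretch
  have htight : ∀ a, ∃ i' j', i a ≤ i' ∧ i' ≤ j' ∧ j' ≤ j a ∧
      ((dist (meshPoint δ (cornerOrbit (β a) (c a) i').1) z ≤ r ∧ R ≤ dist (meshPoint δ (cornerOrbit (β a) (c a) j').1) z) ∨
        (R ≤ dist (meshPoint δ (cornerOrbit (β a) (c a) i').1) z ∧ dist (meshPoint δ (cornerOrbit (β a) (c a) j').1) z ≤ r)) ∧
      ∀ t, i' ≤ t → t < j' → r - δ < dist (meshPoint δ (cornerOrbit (β a) (c a) t).1) z ∧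
        dist (meshPoint δ (cornerOrbit (β a) (c a) t).1) z < R + δ := by
    intro a
    refine exists_tightStretch_W3M (fun t => dist (meshPoint δ (cornerOrbit (β a) (c a) t).1) z) hδ
      (fun t => ?_) (h a).1 (h a).2.1
    have h1 := dist_meshPoint_cornerOrbit_succ_le (β a) (c a) δ t
    rw [abs_of_pos hδ] at h1
    exact le_trans (abs_dist_sub_le _ _ z) h1
  choose i' j' hii' hi'j' hj'j hcross hband using htight
  -- the re-rooted witnesses
  refine ⟨fun a => cornerOrbit (β a) (c a) (i' a), fun _ => 0, fun a => j' a - i' a, fun a => ?_, ?_⟩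
  · -- the orbits of `β' a` and `β a` from the new root agree up to time `j' a - i' a`
    have horb : ∀ t ≤ j' a - i' a, cornerOrbit (β' a) (cornerOrbit (β a) (c a) (i' a)) t =
        cornerOrbit (β a) (c a) (i' a + t) := by
      intro t ht
      rw [cornerOrbit_add_eq]
      refine Literature.Probability.LatticeModels.cornerOrbit_congr _ (fun s hs => ?_) t ht
      rw [← cornerOrbit_add_eq]
      exact hagree a _ (hband a _ (Nat.le_add_right _ _) (by omega)).1
        (hband a _ (Nat.le_add_right _ _) (by omega)).2
    have hj'j_a := hj'j a
    have hi'j'_a := hi'j' a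
    refine ⟨Nat.zero_le _, ?_, ?_, ?_⟩
    · rw [horb 0 (Nat.zero_le _), horb _ le_rfl, Nat.add_zero, Nat.add_sub_cancel' (hi'j' a)]
      exact hcross a
    · intro t _ ht
      dsimp only at ht
      rw [horb t ht]
      exact (h a).2.2.1 _ (le_trans (hii' a) (Nat.le_add_right _ _)) (by omega)
    · intro s t _ hst ht
      dsimp only at ht
      rw [horb s (by omega), horb t ht]
      exact (h a).2.2.2 _ _ (le_trans (hii' a) (Nat.le_add_right _ _)) (by omega) (by omega)
  · intro a b hab s t _ hs _ ht
    dsimp only at hs ht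
    have hj'j_a := hj'j a
    have hj'j_b := hj'j b
    have hi'j'_a := hi'j' a
    have hi'j'_b := hi'j' b
    have horba : ∀ t ≤ j' a - i' a, cornerOrbit (β' a) (cornerOrbit (β a) (c a) (i' a)) t =
        cornerOrbit (β a) (c a) (i' a + t) := by
      intro t ht
      rw [cornerOrbit_add_eq]
      refine Literature.Probability.LatticeModels.cornerOrbit_congr _ (fun s hs => ?_) t ht
      rw [← cornerOrbit_add_eq]
      exact hagree a _ (hband a _ (Nat.le_add_right _ _) (by omega)).1
        (hband a _ (Nat.le_add_right _ _) (by omega)).2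
    have horbb : ∀ t ≤ j' b - i' b, cornerOrbit (β' b) (cornerOrbit (β b) (c b) (i' b)) t =
        cornerOrbit (β b) (c b) (i' b + t) := by
      intro t ht
      rw [cornerOrbit_add_eq]
      refine Literature.Probability.LatticeModels.cornerOrbit_congr _ (fun s hs => ?_) t ht
      rw [← cornerOrbit_add_eq]
      exact hagree b _ (hband b _ (Nat.le_add_right _ _) (by omega)).1
        (hband b _ (Nat.le_add_right _ _) (by omega)).2
    show cornerOrbit (β' a) (cornerOrbit (β a) (c a) (i' a)) s ≠ cornerOrbit (β' b) (cornerOrbit (β b) (c b) (i' b)) t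
    rw [horba s hs, horbb t ht]
    exact hdis a b hab _ _ (le_trans (hii' a) (Nat.le_add_right _ _)) (by omega)
      (le_trans (hii' b) (Nat.le_add_right _ _)) (by omega)

/-! ## Locality of `ufrsStrands` -/

/-- The target edge of a corner whose vertex lies in the open annulus `r - δ < |· - z| < R + δ`
has both endpoints in the closed annulus `r - 2δ ≤ |· - z| ≤ R + 2δ`. -/
theorem cTgt_mem_edgeBand_W3M {δ r R : ℝ} (hδ : 0 ≤ δ) (z : ℂ) (p : Site 2 × Fin 4)
    (h1 : r - δ < dist (meshPoint δ p.1) z) (h2 : dist (meshPoint δ p.1) z < R + δ) :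
    ∀ x ∈ cTgt p, r - 2 * δ ≤ dist (meshPoint δ x) z ∧ dist (meshPoint δ x) z ≤ R + 2 * δ := by
  intro x hx
  simp only [cTgt, Sym2.mem_iff] at hx
  rcases hx with rfl | rfl
  · constructor <;> linarith
  · have h3 := dist_meshPoint_add_cornerUnit_eq δ p.1 (p.2 + 1)
    rw [abs_of_nonneg hδ] at h3
    have h4 := dist_triangle (meshPoint δ (p.1 + cornerUnit (p.2 + 1))) (meshPoint δ p.1) z
    have h5 := dist_triangle (meshPoint δ p.1) (meshPoint δ (p.1 + cornerUnit (p.2 + 1))) z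
    rw [dist_comm (meshPoint δ p.1) (meshPoint δ (p.1 + cornerUnit (p.2 + 1)))] at h5
    constructor <;> linarith

/-- **Locality of the strand-crossing events** (registered sub-goal `determinedBy_ufrsStrands_W3M`):
for `0 < E.δ`, the event `ufrsStrands E w z k r R` is determined by the edges both of
whose endpoints lie in the closed annulus `r - 2 E.δ ≤ |· - z| ≤ R + 2 E.δ`. -/
theorem determinedBy_ufrsStrands_W3M : ∀ (E : DiscreteDobrushin) (w : Site 2) (z : ℂ) (k : ℕ) (r R : ℝ), 0 < E.δ → DeterminedBy (ufrsStrands E w z k r R) {e : Sym2 (Site 2) | ∀ x ∈ e, r - 2 * E.δ ≤ dist (meshPoint E.δ x) z ∧ dist (meshPoint E.δ x) z ≤ R + 2 * E.δ} := by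
  intro E w z k r R hδ
  -- one direction suffices
  suffices key : ∀ ω ω' : BondConfig (Site 2),
      ω ∩ {e : Sym2 (Site 2) | ∀ x ∈ e, r - 2 * E.δ ≤ dist (meshPoint E.δ x) z ∧ dist (meshPoint E.δ x) z ≤ R + 2 * E.δ} =
        ω' ∩ {e : Sym2 (Site 2) | ∀ x ∈ e, r - 2 * E.δ ≤ dist (meshPoint E.δ x) z ∧ dist (meshPoint E.δ x) z ≤ R + 2 * E.δ} →
      ω ∈ ufrsStrands E w z k r R → ω' ∈ ufrsStrands E w z k r R by
    rw [determinedBy_iff]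
    exact fun ω ω' hωω' => ⟨key ω ω' hωω', key ω' ω hωω'.symm⟩
  intro ω ω' hωω' hω
  have hedge : ∀ e : Sym2 (Site 2), (∀ x ∈ e, r - 2 * E.δ ≤ dist (meshPoint E.δ x) z ∧ dist (meshPoint E.δ x) z ≤ R + 2 * E.δ) →
      (e ∈ ω ↔ e ∈ ω') := by
    intro e he
    constructor
    · intro h; exact ((Set.ext_iff.1 hωω' e).1 ⟨h, he⟩).1
    · intro h; exact ((Set.ext_iff.1 hωω' e).2 ⟨h, he⟩).1
  rw [mem_ufrsStrands_iff] at hω ⊢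
  obtain ⟨c, i, j, τ, h, hdis⟩ := hω
  have hagree : ∀ (a : Fin k) (p : Site 2 × Fin 4), r - E.δ < dist (meshPoint E.δ p.1) z →
      dist (meshPoint E.δ p.1) z < R + E.δ →
      (cTgt p ∈ (fun a => if τ a = true then E.bcBondConfig ω' else (shiftData E w).bcBondConfig ω') a ↔
        cTgt p ∈ (fun a => if τ a = true then E.bcBondConfig ω else (shiftData E w).bcBondConfig ω) a) := by
    intro a p hp1 hp2
    have he := hedge (cTgt p) (cTgt_mem_edgeBand_W3M hδ.le z p hp1 hp2)
    by_cases hτ : τ a = true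
    · simp only [hτ, if_true]
      exact (bcBondConfig_congr_W3M E he).symm
    · simp only [hτ]
      exact (bcBondConfig_congr_W3M (shiftData E w) he).symm
  obtain ⟨c', i', j', h'⟩ := strands_transfer_W3M
    (fun a => if τ a = true then E.bcBondConfig ω else (shiftData E w).bcBondConfig ω)
    (fun a => if τ a = true then E.bcBondConfig ω' else (shiftData E w).bcBondConfig ω')
    (fun a f => if τ a = true then E.IsInnerFace f else (shiftData E w).IsInnerFace f) hδ z
    hagree ⟨c, i, j, h, hdis⟩
  exact ⟨c', i', j', τ, h'⟩

/-- The edge annulus lies in the (finite) set of pairs of sites within `R + 2δ` of `z`. -/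
theorem edgeBand_subset_sym2_W3M {δ : ℝ} (hδ : 0 < δ) (z : ℂ) (r R : ℝ) :
    {e : Sym2 (Site 2) | ∀ x ∈ e, r - 2 * δ ≤ dist (meshPoint δ x) z ∧ dist (meshPoint δ x) z ≤ R + 2 * δ} ⊆
      ↑((finite_setOf_dist_meshPoint_le hδ z (R + 2 * δ)).toFinset.sym2) := by
  intro e he
  rw [Finset.mem_coe, Finset.mem_sym2_iff]
  intro x hx
  rw [Set.Finite.mem_toFinset]
  exact (he x hx).2

/-- **Measurability of the strand-crossing events** (`0 < E.δ`): a local event. -/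
theorem measurableSet_ufrsStrands_W3M (E : DiscreteDobrushin) (w : Site 2) (z : ℂ) (k : ℕ) (r R : ℝ)
    (hδ : 0 < E.δ) : MeasurableSet (ufrsStrands E w z k r R) :=
  ((determinedBy_ufrsStrands_W3M E w z k r R hδ).mono
    (edgeBand_subset_sym2_W3M hδ z r R)).measurableSet_of_finset

/-! ## Disjoint annuli carry independent strand events -/

/-- Edge sets cut out by pointwise incompatible conditions on the endpoints are disjoint. -/
theorem disjoint_edgeBands_W3M {P Q : Site 2 → Prop} (hPQ : ∀ x, P x → Q x → False) :
    Disjoint {e : Sym2 (Site 2) | ∀ x ∈ e, P x} {e : Sym2 (Site 2) | ∀ x ∈ e, Q x} := by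
  rw [Set.disjoint_left]
  intro e hP hQ
  induction e using Sym2.ind with
  | h x y => exact hPQ x (hP x (Sym2.mem_mk_left x y)) (hQ x (Sym2.mem_mk_left x y))

/-- **Independence of strand events in disjoint annuli.** If the closed edge annuli
`[r₁ - 2δ, R₁ + 2δ]` around `z₁` and `[r₂ - 2δ, R₂ + 2δ]` around `z₂` contain no common site (as
expressed by the hypothesis `hsep`), the two strand-crossing events are independent under `P_{1/2}`. -/
theorem real_inter_ufrsStrands_W3M (E : DiscreteDobrushin) (w : Site 2) (hδ : 0 < E.δ) {z₁ z₂ : ℂ} {k₁ k₂ : ℕ}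
    {r₁ R₁ r₂ R₂ : ℝ}
    (hsep : ∀ x : Site 2, r₁ - 2 * E.δ ≤ dist (meshPoint E.δ x) z₁ → dist (meshPoint E.δ x) z₁ ≤ R₁ + 2 * E.δ →
      r₂ - 2 * E.δ ≤ dist (meshPoint E.δ x) z₂ → dist (meshPoint E.δ x) z₂ ≤ R₂ + 2 * E.δ → False) :
    (bondPercolation (zdGraph 2) half).real (ufrsStrands E w z₁ k₁ r₁ R₁ ∩ ufrsStrands E w z₂ k₂ r₂ R₂) =
      (bondPercolation (zdGraph 2) half).real (ufrsStrands E w z₁ k₁ r₁ R₁) *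
        (bondPercolation (zdGraph 2) half).real (ufrsStrands E w z₂ k₂ r₂ R₂) :=
  bondPercolation_real_inter_of_disjoint (zdGraph 2) half
    (disjoint_edgeBands_W3M fun x hx hy => hsep x hx.1 hx.2 hy.1 hy.2)
    (determinedBy_ufrsStrands_W3M E w z₁ k₁ r₁ R₁ hδ) (determinedBy_ufrsStrands_W3M E w z₂ k₂ r₂ R₂ hδ)
    (measurableSet_ufrsStrands_W3M E w z₁ k₁ r₁ R₁ hδ) (measurableSet_ufrsStrands_W3M E w z₂ k₂ r₂ R₂ hδ)

end

end Summit.CriticalPhenomena.CardyFormulaZ2.Cruxes.EdgePrecompact.QkzStripBoundaryArm
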